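import Mathlib
import Summits.Ventures.HodgeRepro.LitKType

/-! # K-type bookkeeping of LINE L4 at τ₀ — instances of the held `Correspond` (Ichino Lemma 7.8) -/

namespace Summit.Ventures.HodgeRepro.Tier4.Line4.KTypeCheck

open HodgeRepro.Lit2.KType

/-- `PosAntitone [1]`. -/
theorem posAntitone_one : PosAntitone [1] := ⟨by simp, by simp⟩

/-- `NegAntitone [-1]`. -/
theorem negAntitone_negone : NegAntitone [-1] := ⟨by simp, by simp⟩

/-- (B) at τ₀, pair `(U(1,1), U(2,1))`, `m₀` odd, `n₀ = 0`: the `(1,1)`-cohomological lowest `K`-type `(1,−1; 0)` of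
`U(2,1)` corresponds to the `U(1)×U(1)`-weight `((m₀+3)/2; (m₀−3)/2)` of `U(1,1)` — weight difference `3`. -/
theorem corr_J (m₀ : ℤ) (hm : m₀ % 2 = 1) :
    Correspond 1 1 2 1 m₀ 0 ([(m₀ + 3) / 2], [(m₀ - 3) / 2]) ([1, -1], [0]) := by
  refine ⟨by omega, by omega, [1], [], [], [-1], posAntitone_one, ⟨by simp, by simp⟩, ⟨by simp, by simp⟩,
    negAntitone_negone, by simp, by simp, by simp, by simp, ?_, ?_, ?_, ?_⟩
  · simp [padded]; omega
  · simp [padded]; omega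
  · simp [padded]
  · simp [padded]

/-- The corner form: POSITIVE line `(1,0)` against `U(2,1)`, `n₀ = −1`: the `H^{1,0}` lowest `K`-type `(1,0; −1)` of
`U(2,1)` corresponds to the line character of exponent `(m₀+3)/2`. -/
theorem corr_corner_pos (m₀ : ℤ) (hm : m₀ % 2 = 1) :
    Correspond 1 0 2 1 m₀ (-1) ([(m₀ + 3) / 2], []) ([1, 0], [-1]) := by
  refine ⟨by omega, by omega, [1], [], [], [], posAntitone_one, ⟨by simp, by simp⟩, ⟨by simp, by simp⟩,
    ⟨by simp, by simp⟩, by simp, by simp, by simp, by simp, ?_, ?_, ?_, ?_⟩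
  · simp [padded]; omega
  · simp [padded]
  · simp [padded]
  · simp [padded]

/-- The conjugate corner form: NEGATIVE line `(0,1)` against `U(2,1)`, `n₀ = 1`: the `H^{0,1}` lowest `K`-type
`(0,−1; 1)` corresponds to the line character of exponent `(m₀−3)/2`. -/
theorem corr_corner_neg (m₀ : ℤ) (hm : m₀ % 2 = 1) :
    Correspond 0 1 2 1 m₀ 1 ([], [(m₀ - 3) / 2]) ([0, -1], [1]) := by
  refine ⟨by omega, by omega, [], [], [], [-1], ⟨by simp, by simp⟩, ⟨by simp, by simp⟩, ⟨by simp, by simp⟩,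
    negAntitone_negone, by simp, by simp, by simp, by simp, ?_, ?_, ?_, ?_⟩
  · simp [padded]
  · simp [padded]; omega
  · simp [padded]
  · simp [padded]

/-- (C) at a definite place, pair `(U(1,1), U(3))`, `n₀ = 0`: the trivial `K`-type `(0,0,0)` of `U(3)` corresponds to
`((m₀+3)/2; (m₀−3)/2)` — the lowest `K`-type of `θ^{-1}(1_{U(3)})`, weight difference `3` again. -/
theorem corr_vacuum_def (m₀ : ℤ) (hm : m₀ % 2 = 1) :
    Correspond 1 1 3 0 m₀ 0 ([(m₀ + 3) / 2], [(m₀ - 3) / 2]) ([0, 0, 0], []) := by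
  refine ⟨by omega, by omega, [], [], [], [], ⟨by simp, by simp⟩, ⟨by simp, by simp⟩, ⟨by simp, by simp⟩,
    ⟨by simp, by simp⟩, by simp, by simp, by simp, by simp, ?_, ?_, ?_, ?_⟩
  · simp [padded]; omega
  · simp [padded]; omega
  · simp [padded]
  · simp [padded]

end Summit.Ventures.HodgeRepro.Tier4.Line4.KTypeCheck
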